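import Summits.HubbardSuperconductivity.HubbardLadder.Bounds.FdcEvalSums
import Summits.HubbardSuperconductivity.ManyBodyBootstrap.Bounds.E2.HeisenbergRows
import HarnessLib

/-!
# Hubbard ladder — Bounds: the cluster-mean-field ceiling `E₀(H_L) ≤ -0.58405338…·L²` on every
# even torus `L ≥ 4`, and the E2 claim node `heisTL_upper_2x2_cmf` closed by it

HONEST FRAMING (cell pub-hubbard): ladder R1–R4 with certified numbers; no claim on H/H₀. This is
a bound for a MODEL CLASS — the spin-½ Heisenberg antiferromagnet `H_L = Σ_{⟨xy⟩} 𝐒_x·𝐒_y`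
(`J = 1`) on the torus `(ℤ/Lℤ)²` — obtained from ONE explicit trial state by the variational
principle; no materials claim.

The trial state is the product, over the tiling of the torus `(ℤ/2kℤ)²` (`k ≥ 2`) by `k²`
translates of the open `2 × 2` cluster, of the cluster-mean-field block state `u/‖u‖` of the E2
certificate `heis_tl_upper_2x2_cmf` (`pub-mbboot-sdp2/certs/heis_tl_upper_2x2_cmf.json`, sha256
`1f026b9b4b305e98…`, format `mbboot-e2-cert-v1`, producer job `j048685`; `u ∈ ℤ⁶` on the
two-up-two-down sector of the cluster, `‖u‖² = 1304998835328840596`). Its energy is `k² Φ(u)`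
EXACTLY, where
`Φ = clusterTrialEnergy 1 (2,2) (u/‖u‖)` is the Literature functional of
`HeisenbergClusterProductUpperBound` (open-box energy plus the mean-field boundary terms
`⟨Sᶻ_f⟩⟨Sᶻ_{f+eᵢ}⟩`, the `Sˣ, Sʸ` expectations of a sector state vanishing —
`HeisenbergTL.clusterBondTerm_eq_of_sector`), and the Literature theorem
`heisenbergTorus_groundEnergy_le_clusterProduct` (Anderson 1951; Oguchi 1955; any `k ≥ 2`, so the
`4 × 4` torus IS covered) gives `E₀(H_{2k}) ≤ k² Φ`. The block state breaks the spin-flip symmetry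
(`⟨Sᶻ⟩ = ∓0.438…` on the two sublattices), so each of the four boundary bonds per cluster
contributes `-0.19189…` and each internal bond `-0.39215…`:
`Φ = -2.33621353608… ≤ 4 · (-642173486971/2⁴⁰)`, margin `5.4·10⁻¹²` per cluster. (The remark in
`HeisTorusUpperNeel` that 2×2 product states reach only `-8` on the `4 × 4` torus concerns
flip-symmetric block states, whose boundary terms vanish; the symmetry-broken block state reaches
`4Φ = -9.3448…`.)

Evaluation in kernel: positions `(ℤ/2ℤ)² ≃ Fin 4` and configurations `Fin 16 ≃ (P → Fin 2)`
(`posEquiv`, `cfgEquiv` of `FdcEvalBridge`); with `Sᶻ = ½·sz2`, `S⁺ = sp`, `S⁻ = sm`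
(`FdcEvalSums`) every expectation `⟨u, Sᶻ_m u⟩`, `⟨u, 𝐒_m·𝐒_{m'} u⟩` is an integer double sum over
`Fin 16 × Fin 16` of the tables `osI` / `os2I` (`FdcEval2x2`), evaluated by `decide +kernel`
(`cmfSdir_sz2_eq`, `cmfBond_eq`, `cmfN_eq`); the final inequality is `norm_num` on rationals.
Two independent exact evaluations of `Φ(u)` outside Lean (operator algebra on words / literal
transcription of the integer tables) agree with the certificate's `Phi` to the last digit.

* `heisTorusFamilyUpper_cmf` — `HeisTorusFamilyUpper 2 4 (-642173486971/2⁴⁰)`;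
* `heisTL_upper_2x2_cmf_holds` — the E2 row `heisTL_upper_2x2_cmf` (15th of the 15 square-lattice
  torus-family rows of `E2/HeisenbergRows`; the other 14 are closed by LEAN FILING REQUESTS
  #219/#220/#224).

For even `L ≥ 6` the finite-depth-circuit ceiling `heisTL_fdc_upper_2x2` (`q = -0.6585041`) of
`FdcUpper2x2` is better; the present row is the only one of the family reaching `L = 4`.
Companion text: `pub-hubbard/paper/bounds.tex`; tables `pub-hubbard/pub-hubbard-bounds/BOUNDS.md`.
-/

namespace Summit.HubbardSuperconductivity.HubbardLadder.Bounds

open Matrix Finset Complex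
open Literature.Probability.LatticeModels Literature.MathematicalPhysics.QuantumLattice
open Summit.HubbardSuperconductivity.ManyBodyBootstrap.Bounds.E2

noncomputable section

/-! ### The certificate's integer block vector and the kernel-evaluated sums -/

/-- The block vector `u` of the certificate `heis_tl_upper_2x2_cmf` in the `Fin 16` configuration
coordinates of `FdcEval2x2` (bit `m` of `j` = spin at position `m = δ₀ + 2δ₁`, `0 = ↑`): supported
on the six two-up-two-down words `3, 5, 6, 9, 10, 12` (the certificate's basis order; its
`bit = 1 ↔ ↑` convention differs from the tree's by a global spin flip, under which `Φ` is
invariant); certificate format `mbboot-e2-cert-v1`, exact integers. [folklore] -/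
def cmfI : Fin 16 → ℤ :=
  ![0, 0, 0, -188741951, 0, -188741951, 97893996, 0, 0, 1073741824, -188741951, 0, -188741951,
    0, 0, 0]

/-- `‖u‖²` (exact integer of the certificate). [folklore] -/
def cmfN : ℕ := 1304998835328840596

/-- `⟨u, s⁽ᵐ⁾ u⟩` for an integer one-site table `s` at position `m`, as the direct double sum.
[folklore] -/
def cmfSdir (m : Fin 4) (s : Fin 2 → Fin 2 → ℤ) : ℤ :=
  ∑ j : Fin 16, cmfI j * ∑ j' : Fin 16, osI m s j j' * cmfI j'

/-- `⟨u, s⁽ᵐ⁾ s'⁽ᵐ'⁾ u⟩` for integer one-site tables at positions `m ≠ m'`, as the direct double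
sum. [folklore] -/
def cmfPdir (m : Fin 4) (s : Fin 2 → Fin 2 → ℤ) (m' : Fin 4) (s' : Fin 2 → Fin 2 → ℤ) : ℤ :=
  ∑ j : Fin 16, cmfI j * ∑ j' : Fin 16, os2I m s m' s' j j' * cmfI j'

/-- `2‖u‖²⟨Sᶻ_m⟩_u` at the four positions (sublattice `{0, 3}` down, `{1, 2}` up in the tree's
convention); exact integers. [folklore] -/
def cmfZlit : Fin 4 → ℤ :=
  ![-1143338270153998960, 1143338270153998960, 1143338270153998960, -1143338270153998960]

/-- `4⟨u, 𝐒_m·𝐒_{m'} u⟩` on each of the four internal bonds of the open `2 × 2` cluster (all four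
are equal); exact integer. [folklore] -/
def cmfB : ℤ := -2047052061172834272

/-- `‖u‖² = cmfN` (kernel evaluation). [folklore] -/
theorem cmfN_eq : (∑ j : Fin 16, cmfI j * cmfI j) = (cmfN : ℤ) := by decide +kernel

/-- `u` lies in the two-up-two-down sector (kernel evaluation). [folklore] -/
theorem cmfI_sector :
    ∀ j : Fin 16, cmfI j ≠ 0 → (∑ m : Fin 4, ((fbit m j : Fin 2) : ℕ)) = 2 := by
  decide +kernel

/-- The `Sᶻ` sums (kernel evaluation): `⟨u, sz2⁽ᵐ⁾ u⟩ = cmfZlit m`. [folklore] -/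
theorem cmfSdir_sz2_eq : ∀ m : Fin 4, cmfSdir m sz2 = cmfZlit m := by decide +kernel

/-- The bond sums (kernel evaluation): on every internal bond `(m, m + eᵢ)`, `m_i = 0`,
`⟨u, (sz2 sz2 + 2(sp sm + sm sp)) u⟩ = cmfB`. [folklore] -/
theorem cmfBond_eq : ∀ (i : Fin 2) (m : Fin 4), pbit i m = 0 →
    cmfPdir m sz2 (pflip i m) sz2 +
        2 * (cmfPdir m sp (pflip i m) sm + cmfPdir m sm (pflip i m) sp) = cmfB := by
  decide +kernel

/-! ### The normalised block state -/

/-- `u` in configuration coordinates. [folklore] -/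
def cmfC : TensorIndex FdcP 2 → ℂ := fun l => ((cmfI (cfgEquiv.symm l) : ℤ) : ℂ)

/-- **The block state** `u/‖u‖` of the certificate. [folklore] -/
def cmfHat : TensorIndex FdcP 2 → ℂ := ((Real.sqrt cmfN : ℝ) : ℂ)⁻¹ • cmfC

/-- [folklore] -/
theorem cmfC_cfgEquiv (j : Fin 16) : cmfC (cfgEquiv j) = ((cmfI j : ℤ) : ℂ) := by simp [cmfC]

/-- `(cmfN : ℂ) ≠ 0`. [folklore] -/
private theorem cmfN_cast_ne_zero : (cmfN : ℂ) ≠ 0 := by norm_num [cmfN]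

/-- `(√N)⁻¹ (√N)⁻¹ = N⁻¹`. [folklore] -/
private theorem sqrt_cmfN_inv_mul_inv :
    ((Real.sqrt cmfN : ℝ) : ℂ)⁻¹ * ((Real.sqrt cmfN : ℝ) : ℂ)⁻¹ = ((cmfN : ℂ))⁻¹ := by
  rw [← mul_inv, ← Complex.ofReal_mul, Real.mul_self_sqrt (Nat.cast_nonneg _),
    Complex.ofReal_natCast]

/-- `‖cmfHat‖ = 1`. [folklore] -/
theorem star_cmfHat_dotProduct_cmfHat : star cmfHat ⬝ᵥ cmfHat = 1 := by
  have hcore : star cmfC ⬝ᵥ cmfC = (cmfN : ℂ) := by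
    simp only [dotProduct, Pi.star_apply, sum_cfg, cmfC_cfgEquiv, star_intCast]
    have h := congrArg (fun z : ℤ => (z : ℂ)) cmfN_eq
    push_cast at h
    exact h
  unfold cmfHat
  rw [star_smul, smul_dotProduct, dotProduct_smul, hcore, smul_eq_mul, smul_eq_mul,
    Complex.star_def, map_inv₀, Complex.conj_ofReal, ← mul_assoc, sqrt_cmfN_inv_mul_inv,
    inv_mul_cancel₀ cmfN_cast_ne_zero]

/-- The block state is a sector state (`Σ_y σ_y = 2` on its support). [folklore] -/
theorem cmfHat_sector :
    ∀ σ : TensorIndex FdcP 2, cmfHat σ ≠ 0 → ∑ y, ((σ y : Fin 2) : ℕ) = 2 := by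
  intro σ hσ
  obtain ⟨j, rfl⟩ := cfgEquiv.surjective σ
  have hj : cmfI j ≠ 0 := by
    intro h0
    apply hσ
    simp [cmfHat, cmfC_cfgEquiv, h0]
  have hs : (∑ y : FdcP, ((cfgEquiv j y : Fin 2) : ℕ)) =
      ∑ m : Fin 4, ((cfgEquiv j (posEquiv.symm m) : Fin 2) : ℕ) :=
    (Equiv.sum_comp posEquiv.symm (fun y => ((cfgEquiv j y : Fin 2) : ℕ))).symm
  rw [hs]
  simp only [cfgEquiv_apply, Equiv.apply_symm_apply]
  exact cmfI_sector j hj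

/-! ### Expectations of the block state as integer sums -/

/-- One-site expectations of `u`: `⟨u, s⁽ᵖ⁾ u⟩ = cmfSdir`. [folklore] -/
theorem star_cmfC_onSite_cmfC (p : FdcP) (s : Fin 2 → Fin 2 → ℤ) :
    star cmfC ⬝ᵥ (onSite p (castM s) *ᵥ cmfC) = ((cmfSdir (posEquiv p) s : ℤ) : ℂ) := by
  simp only [dotProduct, mulVec, Pi.star_apply, sum_cfg, cmfC_cfgEquiv, star_intCast,
    onSite_cfgEquiv, castM_apply]
  push_cast [cmfSdir, osI_cast]
  rfl

/-- Two-site expectations of `u` at distinct positions: `⟨u, s⁽ᵖ⁾ s'⁽ᵖ'⁾ u⟩ = cmfPdir`.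
[folklore] -/
theorem star_cmfC_onSite_mul_onSite_cmfC {p p' : FdcP} (hpp : p ≠ p')
    (s s' : Fin 2 → Fin 2 → ℤ) :
    star cmfC ⬝ᵥ ((onSite p (castM s) * onSite p' (castM s')) *ᵥ cmfC) =
      ((cmfPdir (posEquiv p) s (posEquiv p') s' : ℤ) : ℂ) := by
  simp only [dotProduct, mulVec, Pi.star_apply, sum_cfg, cmfC_cfgEquiv, star_intCast,
    onSite_mul_onSite_cfgEquiv hpp, castM_apply]
  push_cast [cmfPdir, os2I_cast]
  rfl

/-- `⟨u, 𝐒_p·𝐒_{p'} u⟩ = (sz2 sz2 + 2(sp sm + sm sp) sum)/4` for `p ≠ p'`. Tasaki (2020) §2.4,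
eq. (2.4.3), via `LiebMattis.spinDot_eq_of_ne`. [folklore] -/
theorem star_cmfC_spinDot_cmfC {p p' : FdcP} (hpp : p ≠ p') :
    star cmfC ⬝ᵥ (spinDot 1 p p' *ᵥ cmfC) =
      ((cmfPdir (posEquiv p) sz2 (posEquiv p') sz2 +
          2 * (cmfPdir (posEquiv p) sp (posEquiv p') sm +
            cmfPdir (posEquiv p) sm (posEquiv p') sp) : ℤ) : ℂ) / 4 := by
  rw [LiebMattis.spinDot_eq_of_ne 1 hpp, spinZ_one_eq, spinRaise_one_eq, spinLower_one_eq]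
  simp only [onSite_smul', Matrix.smul_mul, Matrix.mul_smul, smul_smul, one_smul, add_mulVec,
    Matrix.smul_mulVec, dotProduct_add, dotProduct_smul, star_cmfC_onSite_mul_onSite_cmfC hpp,
    smul_eq_mul]
  push_cast
  ring

/-- The value `⟨Sᶻ_m⟩` of the block state at position `m`. [folklore] -/
def cmfZval (m : Fin 4) : ℝ := ((cmfZlit m : ℤ) : ℝ) / (2 * (cmfN : ℝ))

/-- The value `⟨𝐒_m·𝐒_{m+eᵢ}⟩` of the block state on an internal bond. [folklore] -/
def cmfBval : ℝ := ((cmfB : ℤ) : ℝ) / (4 * (cmfN : ℝ))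

/-- **`⟨Sᶻ_p⟩` of the block state.** [folklore] -/
theorem star_cmfHat_spinZ_cmfHat (p : FdcP) :
    star cmfHat ⬝ᵥ (siteSpin 1 p 2 *ᵥ cmfHat) = ((cmfZval (posEquiv p) : ℝ) : ℂ) := by
  unfold cmfHat siteSpin
  rw [spinVec_two, spinZ_one_eq, onSite_smul', Matrix.smul_mulVec, mulVec_smul, star_smul,
    smul_dotProduct, dotProduct_smul, dotProduct_smul, star_cmfC_onSite_cmfC, cmfSdir_sz2_eq,
    smul_eq_mul, smul_eq_mul, smul_eq_mul, Complex.star_def, map_inv₀, Complex.conj_ofReal]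
  unfold cmfZval
  push_cast
  rw [show ((Real.sqrt cmfN : ℝ) : ℂ)⁻¹ * ((1 / 2 : ℂ) * (((Real.sqrt cmfN : ℝ) : ℂ)⁻¹ *
      ((cmfZlit (posEquiv p) : ℤ) : ℂ))) = (((Real.sqrt cmfN : ℝ) : ℂ)⁻¹ *
      ((Real.sqrt cmfN : ℝ) : ℂ)⁻¹) * ((cmfZlit (posEquiv p) : ℤ) : ℂ) / 2 by ring,
    sqrt_cmfN_inv_mul_inv]
  field_simp

/-- In `(ℤ/2ℤ)²`, `p ≠ p + eᵢ`. [folklore] -/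
private theorem fdcP_ne_add_single (p : FdcP) (i : Fin 2) : p ≠ p + Pi.single i 1 :=
  HeisenbergTL.rectTorusSite_ne_add_single (k := cvec 2) (i := i) (le_refl 2) p

/-- **`⟨𝐒_p·𝐒_{p+eᵢ}⟩` of the block state on an internal bond** (`p_i = 0`). [folklore] -/
theorem star_cmfHat_spinDot_cmfHat (p : FdcP) (i : Fin 2) (hp : p i = 0) :
    star cmfHat ⬝ᵥ (spinDot 1 p (p + Pi.single i 1) *ᵥ cmfHat) = ((cmfBval : ℝ) : ℂ) := by
  unfold cmfHat
  rw [mulVec_smul, star_smul, smul_dotProduct, dotProduct_smul,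
    star_cmfC_spinDot_cmfC (fdcP_ne_add_single p i), posEquiv_add_single,
    cmfBond_eq i (posEquiv p) ((posEquiv_apply_eq_zero_iff p i).1 hp), smul_eq_mul, smul_eq_mul,
    Complex.star_def, map_inv₀, Complex.conj_ofReal]
  unfold cmfBval
  push_cast
  rw [show ((Real.sqrt cmfN : ℝ) : ℂ)⁻¹ * (((Real.sqrt cmfN : ℝ) : ℂ)⁻¹ * (((cmfB : ℤ) : ℂ) / 4)) =
      (((Real.sqrt cmfN : ℝ) : ℂ)⁻¹ * ((Real.sqrt cmfN : ℝ) : ℂ)⁻¹) * ((cmfB : ℤ) : ℂ) / 4 by ring,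
    sqrt_cmfN_inv_mul_inv]
  field_simp

/-- `z.val` cases in `ℤ/2ℤ`. [folklore] -/
private theorem zmod2_eq_zero_or_eq_one (z : ZMod 2) : z = 0 ∨ z = 1 := by
  revert z
  decide

/-! ### The trial energy per cluster -/

/-- The trial energy per cluster of the block state, bond class by bond class. [folklore] -/
def cmfPhi : ℝ :=
  ∑ m : Fin 4, ∑ i : Fin 2, (if pbit i m = 0 then cmfBval else cmfZval m * cmfZval (pflip i m))

/-- **Bond terms of the block state**: internal bonds give `cmfBval`, boundary bonds the mean-field
product `⟨Sᶻ_m⟩⟨Sᶻ_{m+eᵢ}⟩`. Oguchi (1955); `HeisenbergTL.clusterBondTerm_eq_of_sector`.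
[folklore] -/
theorem clusterBondTerm_cmfHat (m : Fin 4) (i : Fin 2) :
    HeisenbergTL.clusterBondTerm 1 (cvec 2) cmfHat (posEquiv.symm m) i =
      if pbit i m = 0 then cmfBval else cmfZval m * cmfZval (pflip i m) := by
  rw [HeisenbergTL.clusterBondTerm_eq_of_sector 1 (cvec 2) cmfHat cmfHat_sector]
  by_cases h : pbit i m = 0
  · have hp : posEquiv.symm m i = 0 := (posEquiv_symm_apply_eq_zero_iff m i).2 h
    have hlt : (posEquiv.symm m i).val + 1 < cvec 2 i := by
      show (posEquiv.symm m i).val + 1 < 2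
      rw [hp, ZMod.val_zero]
      norm_num
    rw [if_pos hlt, if_pos h, star_cmfHat_spinDot_cmfHat _ i hp, Complex.ofReal_re]
  · have hp : posEquiv.symm m i ≠ 0 := fun e => h ((posEquiv_symm_apply_eq_zero_iff m i).1 e)
    have hv : (posEquiv.symm m i).val = 1 := by
      rcases zmod2_eq_zero_or_eq_one (posEquiv.symm m i) with h' | h'
      · exact absurd h' hp
      · rw [h']
        show (1 : ZMod 2).val = 1
        decide
    have hlt : ¬ ((posEquiv.symm m i).val + 1 < cvec 2 i) := by
      show ¬ ((posEquiv.symm m i).val + 1 < 2)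
      omega
    rw [if_neg hlt, if_neg h, star_cmfHat_spinZ_cmfHat, star_cmfHat_spinZ_cmfHat,
      Complex.ofReal_re, Complex.ofReal_re, Equiv.apply_symm_apply, posEquiv_symm_add_single]

/-- Sums over positions as sums over `Fin 4`. [folklore] -/
private theorem sum_pos_real (G : FdcP → ℝ) : (∑ δ, G δ) = ∑ m : Fin 4, G (posEquiv.symm m) :=
  (Equiv.sum_comp posEquiv.symm G).symm

/-- **The trial energy per cluster of the block state** is `cmfPhi`. [folklore] -/
theorem clusterTrialEnergy_cmfHat :
    HeisenbergTL.clusterTrialEnergy 1 (cvec 2) cmfHat = cmfPhi := by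
  unfold HeisenbergTL.clusterTrialEnergy cmfPhi
  rw [sum_pos_real]
  exact Finset.sum_congr rfl fun m _ => Finset.sum_congr rfl fun i _ => clusterBondTerm_cmfHat m i

/-- **The certificate's inequality** `Φ(u) ≤ 4 · (-642173486971/2⁴⁰)` (`Φ = -2.3362135360820…`,
`4q = -2.3362135360766…`); exact rational arithmetic. [folklore] -/
theorem cmfPhi_le : cmfPhi ≤ 4 * ((((-642173486971 : ℚ) / 1099511627776 : ℚ) : ℝ)) := by
  have hpbit : pbit 0 0 = 0 ∧ pbit 0 1 = 1 ∧ pbit 0 2 = 0 ∧ pbit 0 3 = 1 ∧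
      pbit 1 0 = 0 ∧ pbit 1 1 = 0 ∧ pbit 1 2 = 1 ∧ pbit 1 3 = 1 := by decide
  have hpflip : pflip 0 1 = 0 ∧ pflip 0 3 = 2 ∧ pflip 1 2 = 0 ∧ pflip 1 3 = 1 := by decide
  have hz : cmfZlit 0 = -1143338270153998960 ∧ cmfZlit 1 = 1143338270153998960 ∧
      cmfZlit 2 = 1143338270153998960 ∧ cmfZlit 3 = -1143338270153998960 := by decide
  unfold cmfPhi cmfBval cmfZval
  simp only [Fin.sum_univ_four, Fin.sum_univ_two, hpbit, hpflip, hz, cmfB, cmfN]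
  norm_num

/-! ### The ceiling on every even torus and the E2 row -/

/-- **Cluster-mean-field variational ceiling** on the even torus `(ℤ/2kℤ)²`, `k ≥ 2`:
`E₀(Σ_{⟨xy⟩} 𝐒_x·𝐒_y) ≤ k² Φ(u)` with the `2 × 2` cluster-mean-field block state of the
certificate. Anderson (1951); Oguchi (1955); Literature
`heisenbergTorus_groundEnergy_le_clusterProduct`. -/
theorem heisTorus_groundEnergy_le_cmf (k : ℕ) (hk : 2 ≤ k) [NeZero (2 * k)] :
    (heisenbergHamiltonian 1 (torusGraph 2 (2 * k)) 1).groundEnergy ≤ ((k : ℝ) ^ 2) * cmfPhi := by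
  haveI : NeZero k := ⟨by omega⟩
  have h := heisenbergTorus_groundEnergy_le_clusterProduct (L := 2 * k) (k := cvec k) (M := cvec 2)
    1 1 (by omega) (cvec_mul (by omega)) (fun _ => hk) cmfHat star_cmfHat_dotProduct_cmfHat
  rw [clusterTrialEnergy_cmfHat] at h
  simpa [Fin.prod_univ_two, pow_two] using h

/-- **The cluster-mean-field ceiling as a torus-family node**: `E₀(H_L) ≤ -0.58405338401917·L²`
for every even `L ≥ 4` (`HeisTorusFamilyUpper 2 4 (-642173486971/2⁴⁰)`). Anderson (1951);
Oguchi (1955). -/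
theorem heisTorusFamilyUpper_cmf :
    HeisTorusFamilyUpper 2 4 ((-642173486971 : ℚ) / 1099511627776) := by
  intro L _ h2 h4
  obtain ⟨k, rfl⟩ := h2
  have hk2 : 2 ≤ k := by omega
  have hk0 : (0 : ℝ) ≤ ((k : ℝ) ^ 2) := by positivity
  calc (heisenbergHamiltonian 1 (torusGraph 2 (2 * k)) 1).groundEnergy
      ≤ ((k : ℝ) ^ 2) * cmfPhi := heisTorus_groundEnergy_le_cmf k hk2
    _ ≤ ((k : ℝ) ^ 2) * (4 * ((((-642173486971 : ℚ) / 1099511627776 : ℚ) : ℝ))) :=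
        mul_le_mul_of_nonneg_left cmfPhi_le hk0
    _ = ((((-642173486971 : ℚ) / 1099511627776 : ℚ) : ℝ)) * ((2 * k : ℕ) : ℝ) ^ 2 := by
        push_cast; ring

/-- **E2 row `heisTL_upper_2x2_cmf` closed**: `E₀(H_L) ≤ -0.58405338401917·L²` for every even
`L ≥ 4`, from the certificate's cluster-mean-field block state (certificate `heis_tl_upper_2x2_cmf`,
format `mbboot-e2-cert-v1`, evaluated in kernel). Anderson (1951); Oguchi (1955). [folklore] -/
theorem heisTL_upper_2x2_cmf_holds : heisTL_upper_2x2_cmf :=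
  heisTorusFamilyUpper_cmf

end

end Summit.HubbardSuperconductivity.HubbardLadder.Bounds
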